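import Mathlib
import HarnessLib

/-!
# CharDial / JLinPeel — ADAPTED DIAL, part C: the STATE SPACE of the game chain of a block-adapted few-column strategy
(route `CharDial`, item 32604; lens-6 node g18 §11.7 (ii)(β) / §11.8)

The walk game against a BLOCK-ADAPTED `t`-column strategy (cut `g` of block `q = ⌊g/p⌋` accepts iff `acc g S` for the snapshot `S ∈ 𝔽_p^t` of the `t`
column sums at the block boundary `p·q`) is a word-driven automaton (`AdaptDial.run`, part B) on
`St p t = (Fin t → ZMod p) × ZMod 3 × (Bool × Bool)` = (column sums, weight mod 3, Klein-four PARITY REGISTER `π` by its two free bits; `π_w` = parity of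
the accepted cuts so far whose phase `c + g + W_g + w` is `≢ 0 (mod 3)`, one coordinate per hypothetical value `w` of the total weight mod 3):
* `v4read` / `v4flip` / `v4flips`: an accepted cut flips the two coordinates `w ≠ w⋆`, `w⋆ = −(c + g + W_g)`; flips are bijections (`v4flips_injective`),
  and every coordinate readout stays BALANCED after any flips (`card_v4read_v4flips`: exactly 2 of the 4 register values read `true`);
* `blockStep c col acc q` : the block word `a ∈ {0,1}^p` acts by `S ↦ S + Σ aℓ·col(pq+ℓ)`, `w ↦ w + |a|`, `π ↦` the flips of the accepted cuts of the block —
  TRIANGULAR, hence a BIJECTION of `St p t` for every fixed word (`blockStep_bijective`) — the hypothesis of `letterKernel_colSumOne` (part B);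
* `readout L w'` (the trailing `< p` bits and the cuts `g ≥ p·m` conditioned: further flips `L(S,w)` and the final weight class `w'(S,w)`; WIN = `π_{w'}`) is
  BALANCED under the uniform law: `2·#{readout = true} = |St|` (`readout_balanced`) — the hypothesis of `automaton_bias_le` (part B).
What remains for the sixth dial (g19): the modelling identity `ringWinU c y u = readout … (run blockStep m s₀ (blocks u))` for block-adapted junta-free column
presentations, and the window minorisation of the block chain (node §11.7 (ii)(α)).
0 sorry.
-/

set_option autoImplicit false

namespace Summit.QuantumAdvantage.AdviceFreeQNC0.JLinPeel.AdaptDial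

open Finset

/-! ### The Klein-four parity register, by its two free bits -/

/-- read coordinate `w` of the parity register `π ∈ V₄ ⊂ (ℤ/2)³` encoded by its two free bits `(π₀, π₁)` (`π₂ = π₀ ⊕ π₁`). -/
def v4read (π : Bool × Bool) (w : ZMod 3) : Bool :=
  if w = 0 then π.1 else if w = 1 then π.2 else (π.1 != π.2)

/-- flip the two coordinates `w ≠ w⋆` of the parity register (one accepted cut whose phase vanishes exactly at the hypothetical weight class `w⋆`). -/
def v4flip (π : Bool × Bool) (ws : ZMod 3) : Bool × Bool :=
  if ws = 0 then (π.1, !π.2) else if ws = 1 then (!π.1, π.2) else (!π.1, !π.2)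

/-- a flip at `w⋆` keeps coordinate `w⋆` and negates the two others. -/
theorem v4read_v4flip (π : Bool × Bool) (ws w : ZMod 3) :
    v4read (v4flip π ws) w = if w = ws then v4read π w else !(v4read π w) := by
  obtain ⟨π₀, π₁⟩ := π
  unfold v4read v4flip
  fin_cases ws <;> fin_cases w <;> cases π₀ <;> cases π₁ <;> decide

/-- flips are involutions. -/
theorem v4flip_v4flip (π : Bool × Bool) (ws : ZMod 3) : v4flip (v4flip π ws) ws = π := by
  obtain ⟨π₀, π₁⟩ := π
  unfold v4flip
  fin_cases ws <;> cases π₀ <;> cases π₁ <;> decide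

/-- flips are injective. -/
theorem v4flip_injective (ws : ZMod 3) : Function.Injective fun π : Bool × Bool => v4flip π ws :=
  Function.LeftInverse.injective (g := fun π => v4flip π ws) fun π => v4flip_v4flip π ws

/-- apply a list of flips (left to right). -/
def v4flips (L : List (ZMod 3)) (π : Bool × Bool) : Bool × Bool := L.foldl v4flip π

/-- unfolding `v4flips` on a cons. -/
theorem v4flips_cons (a : ZMod 3) (L : List (ZMod 3)) (π : Bool × Bool) : v4flips (a :: L) π = v4flips L (v4flip π a) := rfl

/-- lists of flips are injective. -/
theorem v4flips_injective (L : List (ZMod 3)) : Function.Injective (v4flips L) := by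
  induction L with
  | nil => exact fun π π' h => h
  | cons a L ih => exact fun π π' h => v4flip_injective a (ih h)

/-- lists of flips are bijections of the register. -/
theorem v4flips_bijective (L : List (ZMod 3)) : Function.Bijective (v4flips L) :=
  ⟨v4flips_injective L, Finite.surjective_of_injective (v4flips_injective L)⟩

/-- every coordinate readout is BALANCED on the register: exactly two of the four values read `true`. -/
theorem card_v4read (w : ZMod 3) : (univ.filter fun π : Bool × Bool => v4read π w = true).card = 2 := by
  fin_cases w <;> decide

/-- … and stays balanced after any list of flips (flips are bijections). -/
theorem card_v4read_v4flips (L : List (ZMod 3)) (w : ZMod 3) :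
    (univ.filter fun π : Bool × Bool => v4read (v4flips L π) w = true).card = 2 := by
  rw [← card_v4read w]
  refine Finset.card_bij (fun π _ => v4flips L π) ?_ ?_ ?_
  · intro π hπ
    rw [Finset.mem_filter] at hπ ⊢
    exact ⟨Finset.mem_univ _, hπ.2⟩
  · intro π _ π' _ h
    exact v4flips_injective L h
  · intro π' hπ'
    obtain ⟨π, hπ⟩ := (v4flips_bijective L).2 π'
    refine ⟨π, ?_, hπ⟩
    rw [Finset.mem_filter] at hπ' ⊢
    exact ⟨Finset.mem_univ _, by rw [hπ]; exact hπ'.2⟩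

/-! ### The state space and the block step -/

/-- the state space of the game chain: `t` column sums mod `p`, the weight mod 3, the parity register. -/
abbrev St (p t : ℕ) := (Fin t → ZMod p) × ZMod 3 × (Bool × Bool)

variable {p t : ℕ}

/-- the flips of block `q` on word `a`: cut `g = pq + ℓ` accepts iff `acc g S` (snapshot `S`), and then flips at `w⋆ = −(c + g + w + #{ℓ' < ℓ : a ℓ'})`
(`w` = weight mod 3 at the block boundary; the prefix weight at the cut is `w +` the block's bits before `ℓ`). -/
def blockFlips (c q : ℕ) (acc : ℕ → (Fin t → ZMod p) → Bool) (S : Fin t → ZMod p) (w : ZMod 3) (a : Fin p → Bool) : List (ZMod 3) :=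
  (List.finRange p).filterMap fun ℓ =>
    if acc (p * q + ℓ) S then
      some (-((c : ZMod 3) + ((p * q + (ℓ : ℕ) : ℕ) : ZMod 3) + w + (((univ.filter fun ℓ' : Fin p => ℓ' < ℓ ∧ a ℓ' = true).card : ℕ) : ZMod 3)))
    else none

/-- ★ the BLOCK STEP of the game chain of a block-adapted `t`-column strategy (residue `c`, columns `col i ∈ 𝔽_p^t`, acceptance rule `acc`), block `q`,
on the block word `a ∈ {0,1}^p`: `S ↦ S + Σ_ℓ aℓ·col(pq+ℓ)`, `w ↦ w + |a|`, `π ↦` the block's flips. -/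
def blockStep (c : ℕ) (col : ℕ → Fin t → ZMod p) (acc : ℕ → (Fin t → ZMod p) → Bool) (q : ℕ) (s : St p t) (a : Fin p → Bool) : St p t :=
  (s.1 + ∑ ℓ : Fin p, (if a ℓ then col (p * q + ℓ) else 0),
   s.2.1 + (((univ.filter fun ℓ : Fin p => a ℓ = true).card : ℕ) : ZMod 3),
   v4flips (blockFlips c q acc s.1 s.2.1 a) s.2.2)

/-- the block step is injective in the state for every fixed word (triangular: translation on `S`, translation on `w`, then a state-dependent bijection of `π`). -/
theorem blockStep_injective (c : ℕ) (col : ℕ → Fin t → ZMod p) (acc : ℕ → (Fin t → ZMod p) → Bool) (q : ℕ) (a : Fin p → Bool) :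
    Function.Injective fun s : St p t => blockStep c col acc q s a := by
  rintro ⟨S, w, π⟩ ⟨S', w', π'⟩ h
  simp only [blockStep, Prod.mk.injEq] at h
  obtain ⟨hS, hw, hπ⟩ := h
  have hS' : S = S' := add_right_cancel hS
  have hw' : w = w' := add_right_cancel hw
  subst hS' hw'
  exact Prod.ext rfl (Prod.ext rfl (v4flips_injective _ hπ))

/-- ★ **the block step is a BIJECTION of the state space for every fixed block word** — the hypothesis of `letterKernel_colSumOne` (part B):
the uniform law on `St p t` is invariant under the game chain. -/
theorem blockStep_bijective [NeZero p] (c : ℕ) (col : ℕ → Fin t → ZMod p) (acc : ℕ → (Fin t → ZMod p) → Bool) (q : ℕ) (a : Fin p → Bool) :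
    Function.Bijective fun s : St p t => blockStep c col acc q s a :=
  ⟨blockStep_injective c col acc q a, Finite.surjective_of_injective (blockStep_injective c col acc q a)⟩

/-! ### The readout and its balance -/

/-- the READOUT after the last complete block: the conditioned trailing bits and cuts apply further flips `L (S, w)` and move the weight class to
`w' (S, w)`; the game is won iff coordinate `w'` of the register is set. -/
def readout (L : (Fin t → ZMod p) → ZMod 3 → List (ZMod 3)) (w' : (Fin t → ZMod p) → ZMod 3 → ZMod 3) (s : St p t) : Bool :=
  v4read (v4flips (L s.1 s.2.1) s.2.2) (w' s.1 s.2.1)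

/-- ★ **every readout is BALANCED under the uniform law** (`2·#{readout = true} = |St|`) — the hypothesis of `automaton_bias_le` (part B). -/
theorem readout_balanced [NeZero p] (L : (Fin t → ZMod p) → ZMod 3 → List (ZMod 3)) (w' : (Fin t → ZMod p) → ZMod 3 → ZMod 3) :
    2 * (univ.filter fun s : St p t => readout L w' s = true).card = Fintype.card (St p t) := by
  have hcount : (univ.filter fun s : St p t => readout L w' s = true).card = ∑ S : Fin t → ZMod p, ∑ w : ZMod 3, 2 := by
    rw [Finset.card_filter, Fintype.sum_prod_type]
    refine Finset.sum_congr rfl fun S _ => ?_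
    rw [Fintype.sum_prod_type]
    refine Finset.sum_congr rfl fun w _ => ?_
    simp only [readout]
    rw [← card_v4read_v4flips (L S w) (w' S w), Finset.card_filter]
    exact Finset.sum_congr rfl fun π _ => if_congr Iff.rfl rfl rfl
  rw [hcount, Fintype.card_prod, Fintype.card_prod, Fintype.card_prod]
  simp only [Finset.sum_const, Finset.card_univ, smul_eq_mul, ZMod.card, Fintype.card_bool]
  ring

end Summit.QuantumAdvantage.AdviceFreeQNC0.JLinPeel.AdaptDial
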